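import Literature.MathematicalPhysics.KineticTheory.Hilbert6LinearizedBoltzmann
import Literature.Analysis.UnboundedOperators.LinearizedBoltzmannBddAboveProofs
import Literature.Analysis.UnboundedOperators.LinearizedBoltzmannSymmetryProofs
import Literature.Analysis.UnboundedOperators.LinearizedBoltzmannBurnettBProofs
import Literature.Analysis.UnboundedOperators.LinearizedBoltzmannSpectralGapProofs
import HarnessLib

/-!
# Positivity of the hard-sphere heat conductivity: reduction to the prelude facts

Sibling proof file of `Hilbert6LinearizedBoltzmann.lean` (topic
`Literature/MathematicalPhysics/KineticTheory`), which vendors the named fact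
`Literature.MathematicalPhysics.KineticTheory.hardSphereHeatConductivity_pos`
(`∀ (hd : 2 ≤ d), 0 < hardSphereHeatConductivity d`), where
`hardSphereHeatConductivity d = (2 / (d (d + 2))) ∑_i ⟪B_i, (-L)⁻¹ B_i⟫_M` is the Chapman–Enskog
heat conductivity of the hard-sphere gas, `B_i(v) = ½ vᵢ (|v|² - (d + 2))` the heat-flux Burnett
functions in the standard basis of `ℝ^d`, `L` the linearised hard-sphere collision operator and
`⟪A, (-L)⁻¹ A⟫_M := dirichletFormInv hardSphereLinearizedOp A = ⨆ g, (2⟪A, g⟫_M + ⟪g, L g⟫_M)` the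
variational expression of the quadratic form of the pseudo-inverse of `-L`
(`Literature.Analysis.UnboundedOperators.LinearizedBoltzmann`).

## What is proved here

The **glue** `hardSphereHeatConductivity_pos_of`: the fact follows from the two prelude facts it
is documented to rest on,

* `Literature.Analysis.UnboundedOperators.dirichletFormInv_pos_of_orthogonal_of_ne_zero`
  (`⟪A, (-L)⁻¹ A⟫_M > 0` for a non-zero `A` of temperate growth `M`-orthogonal to the collision
  invariants, velocity dimension `≥ 2`) and
* `Literature.Analysis.UnboundedOperators.burnettB_orthogonal_collisionInvariants`
  (`B_i ⊥_M span {1, v_k, |v|²}`),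

specialised to `E = V d = EuclideanSpace ℝ (Fin d)` with its standard orthonormal basis, together
with the elementary inputs: `finrank ℝ (V d) = d` (Mathlib's `finrank_euclideanSpace_fin`),
and, proved here, the normalising constant `2 / (d (d + 2))` is `> 0`, `Fin d` is non-empty for
`d ≥ 2`, and `B_i ≠ 0`
(`B_i(e_i) = -(d + 1)/2`, `burnettB_basisFun_apply_self`). Once both prelude facts are discharged,
`hardSphereHeatConductivity_pos_holds` is the one-liner
`hardSphereHeatConductivity_pos_of dirichletFormInv_pos_of_orthogonal_of_ne_zero_holds
burnettB_orthogonal_collisionInvariants_holds`.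

## Reduction to the spectral gap alone

Since the sibling proof files of the prelude now discharge the symmetry of `L`
(`maxwellianInner_linearizedCollisionOp_comm_holds`, `…SymmetryProofs`), the orthogonality
`B_i ⊥_M` collision invariants (`burnettB_orthogonal_collisionInvariants_holds`,
`…BurnettBProofs`) and the implication "symmetry + spectral gap ⟹ positivity of the pseudo-inverse
form" (`dirichletFormInv_pos_of_orthogonal_of_ne_zero_of_comm_of_gap`, `…BddAboveProofs`), the
fact is reduced here to the **single** remaining named fact of its trust base, the hard-sphere
spectral gap `le_neg_maxwellianInner_hardSphereLinearizedOp_of_orthogonal` (Baranger–Mouhot 2005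
Thm 1.1; qualitatively CIP 1994 Thm 7.2.5): `hardSphereHeatConductivity_pos_of_gap`. The discharge
`hardSphereHeatConductivity_pos_holds` is then
`hardSphereHeatConductivity_pos_of_gap le_neg_maxwellianInner_hardSphereLinearizedOp_of_orthogonal_holds`.

## Source and mechanism

Cercignani–Illner–Pulvirenti, *The Mathematical Theory of Dilute Gases* (Springer, Applied
Mathematical Sciences 106, 1994), §7.1 (1.9)–(1.10), p. 192 (`L` symmetric, `(h, Lh) ≤ 0` with
equality iff collision invariant) and §7.2, Theorem 7.2.1, p. 197 (self-adjoint, non-positive,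
null space = collision invariants), Theorem 7.2.5, p. 201 (`0` is an isolated eigenvalue: the rest
of the spectrum lies in `(-∞, 0)` away from `0`, i.e. `-L` has a spectral gap on the orthogonal
complement of its null space). Hence `(-L)⁻¹` is a bounded, positive-definite operator on
`(ker L)^⊥` (Saint-Raymond, *Hydrodynamic Limits of the Boltzmann Equation*, LNM 1971 (2009),
Prop. 3.2.2 and Remark 3.2.3, pp. 46–47, where it is applied to the heat flux
`Ψ = ½ v (|v|² - 5)` = our `B` in `d = 3`), and `κ ∝ ∑_i ⟪B_i, (-L)⁻¹ B_i⟫_M > 0` because each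
`B_i ≠ 0` lies in `(ker L)^⊥`. The analytic core (non-positivity and the spectral gap, which in the
variational encoding is exactly the boundedness-above of the family defining `dirichletFormInv`)
is carried by the first prelude fact; this file adds nothing to the trust base.
-/

open MeasureTheory ProbabilityTheory Module
open Literature.Analysis.UnboundedOperators

namespace Literature.MathematicalPhysics.KineticTheory

noncomputable section

variable {d : ℕ}

/-- The value of the heat-flux Burnett function `B_i(v) = ½ vᵢ (|v|² - (d + 2))` (standard basis of
`ℝ^d`) at the basis vector `e_i`: `B_i(e_i) = -(d + 1)/2`. [folklore] -/
theorem burnettB_basisFun_apply_self (i : Fin d) :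
    burnettB (EuclideanSpace.basisFun (Fin d) ℝ) i (EuclideanSpace.basisFun (Fin d) ℝ i) =
      -((d + 1 : ℝ) / 2) := by
  simp only [burnettB, OrthonormalBasis.repr_self, PiLp.single_apply, if_true,
    OrthonormalBasis.norm_eq_one, one_pow, one_mul, finrank_euclideanSpace_fin]
  ring

/-- The heat-flux Burnett functions of `ℝ^d` (standard basis) are non-zero functions
(`B_i(e_i) = -(d + 1)/2 ≠ 0`). [folklore] -/
theorem burnettB_basisFun_ne_zero (i : Fin d) :
    burnettB (EuclideanSpace.basisFun (Fin d) ℝ) i ≠ 0 := by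
  intro h
  have h1 := congrFun h (EuclideanSpace.basisFun (Fin d) ℝ i)
  rw [burnettB_basisFun_apply_self, Pi.zero_apply] at h1
  have h2 : (0 : ℝ) < (d + 1 : ℝ) / 2 := by positivity
  linarith

/-- The normalising constant `2 / (d (d + 2))` of the heat conductivity is strictly positive for
`d ≥ 1` (in particular for `d ≥ 2`). [folklore] -/
theorem heatConductivity_const_pos (hd : 1 ≤ d) : (0 : ℝ) < 2 / (d * (d + 2) : ℝ) := by
  have hd0 : (0 : ℝ) < d := by exact_mod_cast hd
  positivity

/-- Each summand of the heat-conductivity Dirichlet sum is strictly positive,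
`0 < ⟪B_i, (-L)⁻¹ B_i⟫_M` (`d ≥ 2`), *granted* the two prelude facts: positivity of the
pseudo-inverse form on non-zero temperate functions orthogonal to the collision invariants
(CIP 1994 §7.2 Thm 7.2.1, 7.2.5, pp. 197, 201; Saint-Raymond 2009 Prop. 3.2.2, Rem. 3.2.3) and the
orthogonality `B_i ⊥_M span {1, v_k, |v|²}`; the remaining inputs (`B_i` has temperate growth,
`B_i ≠ 0`, `finrank ℝ (V d) = d`) are proved.
[cite: CIP1994, §7.2 Thm 7.2.1 p. 197 and Thm 7.2.5 p. 201] -/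
theorem dirichletFormInv_burnettB_pos (hd : 2 ≤ d)
    (hpos : dirichletFormInv_pos_of_orthogonal_of_ne_zero (E := V d))
    (horth : burnettB_orthogonal_collisionInvariants (E := V d) (ι := Fin d)) (i : Fin d) :
    0 < dirichletFormInv (E := V d) hardSphereLinearizedOp
      (burnettB (EuclideanSpace.basisFun (Fin d) ℝ) i) :=
  hpos (by simpa only [finrank_euclideanSpace_fin] using hd) (burnettB_mem_temperateGrowth _ i)
    (fun _ hφ => horth _ i hφ) (burnettB_basisFun_ne_zero i)

/-- The heat-conductivity Dirichlet sum `∑_i ⟪B_i, (-L)⁻¹ B_i⟫_M` of the hard-sphere gas in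
dimension `d ≥ 2` is strictly positive, granted the two prelude facts (a non-empty sum of strictly
positive terms). [cite: CIP1994, §7.2 Thm 7.2.1 p. 197 and Thm 7.2.5 p. 201] -/
theorem conductivityDirichletSum_pos_of (hd : 2 ≤ d)
    (hpos : dirichletFormInv_pos_of_orthogonal_of_ne_zero (E := V d))
    (horth : burnettB_orthogonal_collisionInvariants (E := V d) (ι := Fin d)) :
    0 < conductivityDirichletSum (E := V d) hardSphereLinearizedOp
      (EuclideanSpace.basisFun (Fin d) ℝ) := by
  unfold conductivityDirichletSum
  have hne : (Finset.univ : Finset (Fin d)).Nonempty :=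
    ⟨⟨0, by omega⟩, Finset.mem_univ _⟩
  exact Finset.sum_pos (fun i _ => dirichletFormInv_burnettB_pos hd hpos horth i) hne

/-- **Glue for `hardSphereHeatConductivity_pos`.** The strict positivity of the hard-sphere heat
conductivity `κ = (2 / (d (d + 2))) ∑_i ⟪B_i, (-L)⁻¹ B_i⟫_M` in dimension `d ≥ 2` follows from the
two prelude facts it is documented to rest on — positivity of the pseudo-inverse form
`⟪A, (-L)⁻¹ A⟫_M` for non-zero temperate `A ⊥_M` collision invariants
(`dirichletFormInv_pos_of_orthogonal_of_ne_zero`: CIP 1994 §7.2, Thm 7.2.1 p. 197 and Thm 7.2.5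
p. 201, `-L ≥ 0` self-adjoint with null space the collision invariants and `0` isolated in the
spectrum; Saint-Raymond 2009 Prop. 3.2.2 / Rem. 3.2.3 pp. 46–47 for the application to the heat
flux `Ψ = B`) and `burnettB_orthogonal_collisionInvariants` — by: the constant is `> 0`, `Fin d`
is non-empty, and every summand is `> 0` (`B_i ≠ 0` of temperate growth).
[cite: CIP1994, §7.2 Thm 7.2.1 p. 197 and Thm 7.2.5 p. 201] -/
theorem hardSphereHeatConductivity_pos_of
    (hpos : dirichletFormInv_pos_of_orthogonal_of_ne_zero (E := V d))
    (horth : burnettB_orthogonal_collisionInvariants (E := V d) (ι := Fin d)) :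
    hardSphereHeatConductivity_pos (d := d) := by
  intro hd
  unfold hardSphereHeatConductivity
  exact mul_pos (heatConductivity_const_pos (by omega)) (conductivityDirichletSum_pos_of hd hpos horth)

/-- **`hardSphereHeatConductivity_pos` from the spectral gap alone.** In dimension `d ≥ 2` the
hard-sphere heat conductivity `κ = (2 / (d (d + 2))) ∑_i ⟪B_i, (-L)⁻¹ B_i⟫_M` is strictly positive
*granted only* the spectral gap of the linearised hard-sphere operator on the `M`-orthogonal
complement of the collision invariants (named fact
`le_neg_maxwellianInner_hardSphereLinearizedOp_of_orthogonal`; Baranger–Mouhot, Rev. Mat.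
Iberoam. 21 (2005) Thm 1.1, qualitatively CIP 1994 §7.2 Thm 7.2.5, p. 201: `0` is isolated in
`σ(L)`). All other inputs are proved in the tree: symmetry of `L` (CIP 1994 §7.1 (7.1.9), p. 192;
`maxwellianInner_linearizedCollisionOp_comm_holds`), the bound `‖A‖²_M / λ` of the variational
family and the test function `g = ε A`
(`dirichletFormInv_pos_of_orthogonal_of_ne_zero_of_comm_of_gap`), the orthogonality of the
heat-flux Burnett functions (`burnettB_orthogonal_collisionInvariants_holds`), and the glue
`hardSphereHeatConductivity_pos_of` above.
[cite: CIPDiluteGases1994, §7.2 Thm 7.2.1 p. 197 and Thm 7.2.5 p. 201] -/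
theorem hardSphereHeatConductivity_pos_of_gap
    (hZ : le_neg_maxwellianInner_hardSphereLinearizedOp_of_orthogonal (E := V d)) :
    hardSphereHeatConductivity_pos (d := d) :=
  hardSphereHeatConductivity_pos_of
    (dirichletFormInv_pos_of_orthogonal_of_ne_zero_of_comm_of_gap
      maxwellianInner_linearizedCollisionOp_comm_holds hZ)
    burnettB_orthogonal_collisionInvariants_holds

/-- **Discharge of `hardSphereHeatConductivity_pos`** (hilbert6.S19). In dimension `d ≥ 2` the
hard-sphere heat conductivity `κ = (2 / (d (d + 2))) ∑_i ⟪B_i, (-L)⁻¹ B_i⟫_M` is strictly positive.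
Every input is now proved in the tree: the spectral gap of the linearised hard-sphere operator on
the `M`-orthogonal complement of the collision invariants
(`le_neg_maxwellianInner_hardSphereLinearizedOp_of_orthogonal_holds`, Grad 1963 §4 /
Baranger–Mouhot 2005 Thm 1.1; qualitatively CIP 1994 §7.2 Thm 7.2.5, p. 201: `0` is an isolated
point of `σ(L)` with eigenspace the collision invariants, Thm 7.2.1 p. 197: `L` self-adjoint and
non-positive), fed to `hardSphereHeatConductivity_pos_of_gap` above (symmetry of `L`, CIP 1994 §7.1
(7.1.9) p. 192; orthogonality of the heat-flux Burnett functions `B_i` to the invariants and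
`B_i ≠ 0`; the application of `(-L)⁻¹` to the heat flux as in Saint-Raymond 2009 Prop. 3.2.2 /
Rem. 3.2.3, pp. 46–47).
[cite: CIPDiluteGases1994, §7.2 Thm 7.2.1 p. 197 and Thm 7.2.5 p. 201] -/
theorem hardSphereHeatConductivity_pos_holds : hardSphereHeatConductivity_pos (d := d) :=
  hardSphereHeatConductivity_pos_of_gap
    le_neg_maxwellianInner_hardSphereLinearizedOp_of_orthogonal_holds

end

end Literature.MathematicalPhysics.KineticTheory
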